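import Mathlib
import HarnessLib
import Literature.Analysis.FluidPDE.RieszPressureLocality
import Literature.Analysis.FluidPDE.AssociatedPressureLocalBound

/-!
# Crux `QuarterLogPincer.TypeIQuantSubcubicExp` (stmt-NavierStokesRegularity-24077), line `thin_cascade`:
  the far field of the whole-space pressure — kernel representation for fields of UNBOUNDED support
  and the two-centre oscillation bound

Helper file (`--supports stmt-NavierStokesRegularity-24077 --as helper`, lead prover ns-tc-p1 g3) toward
the registered 4th stub `stub_uniformScaledEnergy : UniformScaledEnergy` (skeleton v5 of
`Cruxes/TypeIQuantSubcubicExp/Lines/thin_cascade.lean`): the uniformly-local Gronwall argument behind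
clause `A` needs, on every time slice, the oscillation of the whole-space pressure `Π[u(t)]`
(`rieszPressure`) over a ball `B(a, L)` controlled by uniformly local quantities.  The near field
`Π[1_{B(a,2L)} u]` is Calderón–Zygmund (`eLpNorm_rieszPressure_le`); this file treats the FAR field
`Π[1_{B(a,2L)ᶜ} u]`, whose support is unbounded (the tree's representation lemma
`rieszPressure_ae_eq_integral_pressureKernel` assumes bounded support):

* `integrableOn_norm_sq_div_norm_sub_cube` — `‖U‖²/‖y − a‖³ ∈ L¹(B(a,r)ᶜ)` for `U ∈ L³` (the tree's
  `integrableOn_norm_sq_div_norm_cube`, translated);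
* `integrable_pressureKernel_of_vanish` — `y ↦ K(x−y)(U y)` is integrable for `U ∈ L³` vanishing on
  `B(a,R)` and `x ∈ B(a,R')`, `R' < R` (no bounded-support hypothesis);
* `rieszPressure_ae_eq_integral_pressureKernel_of_vanish` — **the far-field representation**:
  `Π[U](x) = ∫ K(x−y)(U y) dy` for a.e. `x ∈ B(a,R')` whenever `U ∈ L³` vanishes on `B(a,R)`, `R' < R`
  (truncate `U = 1_{B(a,M)}U + 1_{B(a,M)ᶜ}U`; additivity `rieszPressure_add_ae_eq_of_disjoint`; the tree's
  representation for the bounded piece; `‖Π[1_{B(a,M)ᶜ}U]‖_{3/2} ≲ ‖1_{B(a,M)ᶜ}U‖₃² → 0`, so it tends to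
  `0` a.e. along a subsequence, while the kernel integrals converge by dominated convergence — the
  scheme of the tree's `ae_abs_sub_rieszPressure_indicator_le`);
* `exists_ae_abs_rieszPressure_sub_near_sub_const_le` — **the two-centre oscillation bound**: for
  `U ∈ L³`, `L > 0` there is a constant `κ` with
  `|Π[U](x) − Π[1_{B(a,2L)}U](x) − κ| ≤ C_K · L · ∫_{B(a,2L)ᶜ} ‖U‖²/‖y−a‖⁴` for a.e. `x ∈ B(a,L)`
  (`C_K` the absolute constant of `exists_abs_integral_pressureKernel_sub_le`).

HONEST FRAMING: whole-space harmonic analysis of the Riesz pressure, serving one registered stub of an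
open crux; nothing about Navier–Stokes regularity is proved; no summit statement is proved by this file.
-/

noncomputable section

-- the summit-side namespace `Summit.NavierStokesRegularity.NavierStokesRegularity.…` (single-conjunct summit,
-- D-0017) repeats a component by design; the dupNamespace linter would flag every declaration.
set_option linter.dupNamespace false

namespace Summit.NavierStokesRegularity.NavierStokesRegularity.Theorems.ThinCascade

open MeasureTheory Set Function Metric Filter Topology
open scoped ENNReal NNReal
open Literature.Analysis Literature.Analysis.FluidPDE

/-! ### Far weights about a general centre -/

/-- **The far weight `‖U‖²/‖y − a‖³` is integrable off `B(a, r)`** for `U ∈ L³(ℝ³)`, `r > 0`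
(the tree's `integrableOn_norm_sq_div_norm_cube`, `p = 3`, transported by the translation `y = a + z`).
[folklore] -/
theorem integrableOn_norm_sq_div_norm_sub_cube
    {U : EuclideanSpace ℝ (Fin 3) → EuclideanSpace ℝ (Fin 3)} (hU : MemLp U 3 volume)
    (a : EuclideanSpace ℝ (Fin 3)) {r : ℝ} (hr : 0 < r) :
    IntegrableOn (fun y => ‖U y‖ ^ 2 / ‖y - a‖ ^ 3) (ball a r)ᶜ volume := by
  have hmp : MeasurePreserving (fun z : EuclideanSpace ℝ (Fin 3) => a + z) volume volume :=
    measurePreserving_add_left volume a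
  have hme : MeasurableEmbedding (fun z : EuclideanSpace ℝ (Fin 3) => a + z) :=
    (MeasurableEquiv.addLeft a).measurableEmbedding
  have hV : MemLp (fun z => U (a + z)) (ENNReal.ofReal 3) volume := by
    rw [show ENNReal.ofReal 3 = (3 : ℝ≥0∞) by norm_num]
    exact hU.comp_measurePreserving hmp
  have h0 := integrableOn_norm_sq_div_norm_cube (by norm_num : (2 : ℝ) < 3) hV hr
  have hpre : (fun z : EuclideanSpace ℝ (Fin 3) => a + z) ⁻¹' (ball a r)ᶜ =
      (ball (0 : EuclideanSpace ℝ (Fin 3)) r)ᶜ := by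
    ext z
    simp [mem_ball, dist_eq_norm]
  have h1 : IntegrableOn ((fun y => ‖U y‖ ^ 2 / ‖y - a‖ ^ 3) ∘ fun z => a + z)
      ((fun z : EuclideanSpace ℝ (Fin 3) => a + z) ⁻¹' (ball a r)ᶜ) volume := by
    rw [hpre]
    refine h0.congr_fun (fun z _ => ?_) measurableSet_ball.compl
    simp [Function.comp]
  exact (hmp.integrableOn_comp_preimage hme).1 h1

/-- **The far weight `‖U‖²/‖y − a‖⁴` is integrable off `B(a, r)`** for `U ∈ L³(ℝ³)`, `r > 0`
(`‖y−a‖⁻⁴ ≤ r⁻¹ ‖y−a‖⁻³` there). [folklore] -/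
theorem integrableOn_norm_sq_div_norm_sub_pow_four
    {U : EuclideanSpace ℝ (Fin 3) → EuclideanSpace ℝ (Fin 3)} (hU : MemLp U 3 volume)
    (a : EuclideanSpace ℝ (Fin 3)) {r : ℝ} (hr : 0 < r) :
    IntegrableOn (fun y => ‖U y‖ ^ 2 / ‖y - a‖ ^ 4) (ball a r)ᶜ volume := by
  have h3 := integrableOn_norm_sq_div_norm_sub_cube hU a hr
  refine Integrable.mono' (h3.const_mul r⁻¹) ?_ ?_
  · refine ((hU.1.norm.aemeasurable.pow_const 2).div
      ((measurable_id.sub_const a).norm.pow_const 4).aemeasurable).aestronglyMeasurable.restrict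
  · refine (ae_restrict_mem measurableSet_ball.compl).mono fun y hy => ?_
    rw [mem_compl_iff, mem_ball, dist_eq_norm, not_lt] at hy
    have hy0 : 0 < ‖y - a‖ := lt_of_lt_of_le hr hy
    rw [Real.norm_of_nonneg (by positivity)]
    rw [show ‖U y‖ ^ 2 / ‖y - a‖ ^ 4 = ‖y - a‖⁻¹ * (‖U y‖ ^ 2 / ‖y - a‖ ^ 3) by
      field_simp]
    exact mul_le_mul_of_nonneg_right ((inv_le_inv₀ hy0 hr).2 hy) (by positivity)

/-- **Integrability of the far kernel integrand** `y ↦ K(x−y)(U y)` for `U ∈ L³` vanishing on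
`B(a, R)` and `x ∈ B(a, R')`, `R' < R`: `|K(x−y)(U y)| ≤ ‖U y‖²/(2π‖x−y‖³)` and
`‖x − y‖ ≥ (1 − R'/R)‖y − a‖` off `B(a,R)`. No bounded-support hypothesis. [folklore] -/
theorem integrable_pressureKernel_of_vanish
    {U : EuclideanSpace ℝ (Fin 3) → EuclideanSpace ℝ (Fin 3)} (hU : MemLp U 3 volume)
    {a x : EuclideanSpace ℝ (Fin 3)} {R R' : ℝ} (hR' : 0 < R') (hR'R : R' < R)
    (hvan : ∀ y ∈ ball a R, U y = 0) (hx : x ∈ ball a R') :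
    Integrable (fun y => pressureKernel (x - y) (U y)) := by
  have hR : 0 < R := hR'.trans hR'R
  set θ : ℝ := (R - R') / R with hθ
  have hθ0 : 0 < θ := by rw [hθ]; exact div_pos (by linarith) hR
  have hW := integrableOn_norm_sq_div_norm_sub_cube hU a hR
  have hdom : Integrable (fun y => (ball a R)ᶜ.indicator (fun y => ‖U y‖ ^ 2 / ‖y - a‖ ^ 3) y *
      (2 * Real.pi * θ ^ 3)⁻¹) :=
    (hW.integrable_indicator measurableSet_ball.compl).mul_const _
  refine hdom.mono' (aestronglyMeasurable_pressureKernel_sub_apply hU.1 x)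
    (Eventually.of_forall fun y => ?_)
  by_cases hy : y ∈ ball a R
  · rw [hvan y hy, pressureKernel_zero_right, norm_zero]
    exact mul_nonneg (indicator_nonneg (fun _ _ => by positivity) _) (by positivity)
  · rw [indicator_of_mem (mem_compl hy), Real.norm_eq_abs]
    rw [mem_ball, dist_eq_norm, not_lt] at hy
    rw [mem_ball, dist_eq_norm] at hx
    have hya0 : 0 < ‖y - a‖ := lt_of_lt_of_le hR hy
    -- `‖x - y‖ ≥ θ ‖y - a‖`
    have hxy : θ * ‖y - a‖ ≤ ‖x - y‖ := by
      have h1 : ‖y - a‖ ≤ ‖x - y‖ + ‖x - a‖ := by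
        calc ‖y - a‖ = ‖(x - a) - (x - y)‖ := by congr 1; abel
          _ ≤ ‖x - a‖ + ‖x - y‖ := norm_sub_le _ _
          _ = ‖x - y‖ + ‖x - a‖ := add_comm _ _
      have h2 : θ * ‖y - a‖ = ‖y - a‖ - R' / R * ‖y - a‖ := by rw [hθ]; field_simp
      have h3 : R' ≤ R' / R * ‖y - a‖ := by
        rw [div_mul_eq_mul_div, le_div_iff₀ hR]
        exact mul_le_mul_of_nonneg_left hy hR'.le
      linarith
    have hxy0 : 0 < ‖x - y‖ := lt_of_lt_of_le (by positivity) hxy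
    calc |pressureKernel (x - y) (U y)| ≤ ‖U y‖ ^ 2 / (2 * Real.pi * ‖x - y‖ ^ 3) :=
          abs_pressureKernel_le _ _
      _ ≤ ‖U y‖ ^ 2 / (2 * Real.pi * (θ * ‖y - a‖) ^ 3) := by
          gcongr
      _ = ‖U y‖ ^ 2 / ‖y - a‖ ^ 3 * (2 * Real.pi * θ ^ 3)⁻¹ := by
          field_simp

/-! ### The far-field representation for unbounded support -/

-- nested operator types
set_option maxSynthPendingDepth 3 in
/-- **The far-field representation of the whole-space pressure, unbounded support.** Let
`U ∈ L³(ℝ³; ℝ³)` vanish on the ball `B(a, R)` and let `0 < R' < R`. Then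
`Π[U](x) = ∫ K(x−y)(U y) dy` for a.e. `x ∈ B(a, R')`, `K(z)(b) = (3⟨z,b⟩² − |b|²|z|²)/(4π|z|⁵)`.
Proof: with `M_n ↑ ∞`, `U = 1_{B(a,M_n)}U + 1_{B(a,M_n)ᶜ}U`, so
`Π[U] = Π[1_{B(a,M_n)}U] + Π[1_{B(a,M_n)ᶜ}U]` a.e. (additivity over disjoint supports); the first term
is the kernel integral of the truncated field on `B(a,R')` (the tree's bounded-support representation)
and converges to `∫ K(x−y)(U y) dy` by dominated convergence; the second has
`‖·‖_{3/2} ≤ C_S ‖1_{B(a,M_n)ᶜ}U‖₃² → 0`, hence tends to `0` a.e. along a subsequence. [folklore] -/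
theorem rieszPressure_ae_eq_integral_pressureKernel_of_vanish
    {U : EuclideanSpace ℝ (Fin 3) → EuclideanSpace ℝ (Fin 3)} (hU : MemLp U 3 volume)
    {a : EuclideanSpace ℝ (Fin 3)} {R R' : ℝ} (hR' : 0 < R') (hR'R : R' < R)
    (hvan : ∀ y ∈ ball a R, U y = 0) :
    ∀ᵐ x ∂(volume.restrict (ball a R')),
      rieszPressure U x = ∫ y, pressureKernel (x - y) (U y) := by
  have hR : 0 < R := hR'.trans hR'R
  have h32_1 : (1 : ℝ≥0∞) < 3 / 2 :=
    (ENNReal.lt_div_iff_mul_lt (Or.inl (by norm_num)) (Or.inl (by norm_num))).2 (by norm_num)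
  -- truncation radii and the truncated fields
  set M : ℕ → ℝ := fun n => R + (n + 1) with hM
  have hMR : ∀ n, R < M n := fun n => by
    simp only [hM]
    linarith [n.cast_nonneg (α := ℝ)]
  set Uin : ℕ → EuclideanSpace ℝ (Fin 3) → EuclideanSpace ℝ (Fin 3) :=
    fun n => (ball a (M n)).indicator U with hUin
  set Uout : ℕ → EuclideanSpace ℝ (Fin 3) → EuclideanSpace ℝ (Fin 3) :=
    fun n => (ball a (M n))ᶜ.indicator U with hUout
  have hUin3 : ∀ n, MemLp (Uin n) 3 volume := fun n => hU.indicator measurableSet_ball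
  have hUout3 : ∀ n, MemLp (Uout n) 3 volume := fun n => hU.indicator measurableSet_ball.compl
  -- (a) additivity: `Π[U] = Π[Uin n] + Π[Uout n]` a.e.
  have ha : ∀ n, rieszPressure U =ᵐ[volume]
      fun x => rieszPressure (Uin n) x + rieszPressure (Uout n) x := by
    intro n
    refine rieszPressure_add_ae_eq_of_disjoint hU (hUin3 n) (hUout3 n) (fun y => ?_)
      (ae_of_all _ fun y => ?_)
    · by_cases hy : y ∈ ball a (M n)
      · right
        simp only [hUout]
        exact indicator_of_notMem (show y ∉ (ball a (M n))ᶜ from fun h => h hy) _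
      · left
        simp only [hUin]
        exact indicator_of_notMem hy _
    · simp only [hUin, hUout]
      rw [Set.indicator_self_add_compl]
  -- (b) kernel representation of the truncated piece on `B(a, R')`
  have hb : ∀ n, ∀ᵐ x ∂(volume.restrict (ball a R')),
      rieszPressure (Uin n) x = ∫ y, pressureKernel (x - y) (Uin n y) := by
    intro n
    refine rieszPressure_ae_eq_integral_pressureKernel (a := a) (R := R) (R₁ := M n)
      (hUin3 n) hR' hR'R (fun y hy => ?_) (fun y hy => ?_)
    · simp only [hUin]
      by_cases hyM : y ∈ ball a (M n)
      · rw [indicator_of_mem hyM, hvan y hy]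
      · rw [indicator_of_notMem hyM]
    · simp only [hUin]
      exact indicator_of_notMem (fun h => hy (ball_subset_closedBall h)) _
  -- (c) the kernel integrals of the truncations converge (dominated convergence)
  have hc : ∀ x ∈ ball a R', Tendsto (fun n => ∫ y, pressureKernel (x - y) (Uin n y)) atTop
      (𝓝 (∫ y, pressureKernel (x - y) (U y))) := by
    intro x hx
    have hint := integrable_pressureKernel_of_vanish hU hR' hR'R hvan hx
    refine tendsto_integral_of_dominated_convergence (fun y => ‖pressureKernel (x - y) (U y)‖)
      (fun n => aestronglyMeasurable_pressureKernel_sub_apply (hUin3 n).1 x) hint.norm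
      (fun n => Eventually.of_forall fun y => ?_) (Eventually.of_forall fun y => ?_)
    · simp only [hUin]
      by_cases hy : y ∈ ball a (M n)
      · rw [indicator_of_mem hy]
      · rw [indicator_of_notMem hy, pressureKernel_zero_right, norm_zero]
        exact norm_nonneg _
    · -- eventually constant
      obtain ⟨N, hN⟩ := exists_nat_gt (‖y - a‖ - R - 1)
      refine tendsto_atTop_of_eventually_const (i₀ := N) fun n hn => ?_
      simp only [hUin]
      rw [indicator_of_mem]
      rw [mem_ball, dist_eq_norm]
      simp only [hM]
      have : (N : ℝ) ≤ n := Nat.cast_le.2 hn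
      linarith
  -- (d) `Π[Uout n] → 0` in `L^{3/2}`, hence a.e. along a subsequence
  have hT : Tendsto (fun n => ∫ y in (ball a (M n))ᶜ, ‖U y‖ ^ (3 : ℝ)) atTop (𝓝 0) := by
    have hUpi : Integrable (fun y => ‖U y‖ ^ (3 : ℝ)) (volume : Measure (EuclideanSpace ℝ (Fin 3))) := by
      have h := hU.integrable_norm_rpow (by norm_num) (by norm_num)
      rwa [ENNReal.toReal_ofNat] at h
    have hmeas : ∀ n, MeasurableSet (ball a (M n))ᶜ := fun n => measurableSet_ball.compl
    have hanti : Antitone fun n => (ball a (M n))ᶜ := by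
      intro m n hmn
      refine compl_subset_compl.2 (ball_subset_ball ?_)
      simp only [hM]
      have : (m : ℝ) ≤ n := Nat.cast_le.2 hmn
      linarith
    have h := tendsto_setIntegral_of_antitone (μ := volume) (f := fun y => ‖U y‖ ^ (3 : ℝ)) hmeas
      hanti ⟨0, hUpi.integrableOn⟩
    have hempty : (⋂ n, (ball a (M n))ᶜ) = ∅ := by
      ext y
      simp only [mem_iInter, mem_compl_iff, mem_ball, dist_eq_norm, not_lt, mem_empty_iff_false,
        iff_false, not_forall, not_le]
      obtain ⟨n, hn⟩ := exists_nat_gt (‖y - a‖ - R - 1)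
      refine ⟨n, ?_⟩
      simp only [hM]
      linarith
    rwa [hempty, Measure.restrict_empty, integral_zero_measure] at h
  have hRto : Tendsto (fun n => eLpNorm (rieszPressure (Uout n) - 0) (3 / 2 : ℝ≥0∞) volume)
      atTop (𝓝 0) := by
    simp only [sub_zero]
    have hnorm : ∀ n, eLpNorm (Uout n) 3 volume =
        ENNReal.ofReal ((∫ y in (ball a (M n))ᶜ, ‖U y‖ ^ (3 : ℝ)) ^ (3 : ℝ)⁻¹) := by
      intro n
      simp only [hUout]
      rw [eLpNorm_indicator_eq_eLpNorm_restrict measurableSet_ball.compl,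
        (hU.restrict _).eLpNorm_eq_integral_rpow_norm (by norm_num) (by norm_num),
        ENNReal.toReal_ofNat]
    have hbd : ∀ n, eLpNorm (rieszPressure (Uout n)) (3 / 2 : ℝ≥0∞) volume ≤
        (steinConstThreeHalves : ℝ≥0∞) * ENNReal.ofReal
          (((∫ y in (ball a (M n))ᶜ, ‖U y‖ ^ (3 : ℝ)) ^ (3 : ℝ)⁻¹) ^ 2) := by
      intro n
      have h := eLpNorm_rieszPressure_le (hUout3 n)
      rw [hnorm n, ← ENNReal.ofReal_pow (Real.rpow_nonneg (integral_nonneg fun y => by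
        positivity) _)] at h
      exact h
    have hlim : Tendsto (fun n => (steinConstThreeHalves : ℝ≥0∞) * ENNReal.ofReal
        (((∫ y in (ball a (M n))ᶜ, ‖U y‖ ^ (3 : ℝ)) ^ (3 : ℝ)⁻¹) ^ 2)) atTop (𝓝 0) := by
      have h1 : Tendsto (fun n => ((∫ y in (ball a (M n))ᶜ, ‖U y‖ ^ (3 : ℝ)) ^ (3 : ℝ)⁻¹) ^ 2)
          atTop (𝓝 0) := by
        have := (hT.rpow_const (p := (3 : ℝ)⁻¹) (Or.inr (by positivity))).pow 2
        rwa [Real.zero_rpow (by positivity), zero_pow two_ne_zero] at this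
      have h2 := ENNReal.tendsto_ofReal h1
      rw [ENNReal.ofReal_zero] at h2
      have h3 := ENNReal.Tendsto.const_mul (a := (steinConstThreeHalves : ℝ≥0∞)) h2
        (Or.inr ENNReal.coe_ne_top)
      rwa [mul_zero] at h3
    exact tendsto_of_tendsto_of_tendsto_of_le_of_le tendsto_const_nhds hlim (fun _ => bot_le) hbd
  have hRmeas : TendstoInMeasure volume (fun n => rieszPressure (Uout n)) atTop
      (fun _ => (0 : ℝ)) :=
    tendstoInMeasure_of_tendsto_eLpNorm (by
      intro h0
      rw [h0] at h32_1
      exact absurd h32_1 (by norm_num)) (fun n => (memLp_rieszPressure (hUout3 n)).1)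
      aestronglyMeasurable_const hRto
  obtain ⟨ns, hns_mono, hns⟩ := hRmeas.exists_seq_tendsto_ae
  -- (e) assemble on `B(a, R')`
  have hall : ∀ᵐ x ∂(volume.restrict (ball a R')), ∀ n,
      rieszPressure U x = (∫ y, pressureKernel (x - y) (Uin n y)) + rieszPressure (Uout n) x := by
    rw [ae_all_iff]
    intro n
    have g1 := ae_restrict_of_ae (s := ball a R') (ha n)
    have g2 := hb n
    filter_upwards [g1, g2] with x h1 h2
    rw [h1, h2]
  have hmem : ∀ᵐ x ∂(volume.restrict (ball a R')), x ∈ ball a R' :=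
    ae_restrict_mem measurableSet_ball
  have hns' := ae_restrict_of_ae (s := ball a R') hns
  filter_upwards [hall, hmem, hns'] with x hx hxB hlimx
  have h1 : Tendsto (fun i => (∫ y, pressureKernel (x - y) (Uin (ns i) y)) +
      rieszPressure (Uout (ns i)) x) atTop (𝓝 ((∫ y, pressureKernel (x - y) (U y)) + 0)) :=
    ((hc x hxB).comp hns_mono.tendsto_atTop).add hlimx
  rw [add_zero] at h1
  have h2 : Tendsto (fun i => (∫ y, pressureKernel (x - y) (Uin (ns i) y)) +
      rieszPressure (Uout (ns i)) x) atTop (𝓝 (rieszPressure U x)) :=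
    tendsto_const_nhds.congr fun i => hx (ns i)
  exact tendsto_nhds_unique h2 h1

/-! ### The two-centre oscillation bound for the far field -/

/-- **The two-centre oscillation bound for the far part of the whole-space pressure.** For
`U ∈ L³(ℝ³; ℝ³)`, a centre `a` and `L > 0` there is a constant `κ` (the far kernel integral at the
centre, `κ = ∫ K(a−y)(1_{B(a,2L)ᶜ}U)(y) dy`) such that for a.e. `x ∈ B(a, L)`
`|Π[U](x) − Π[1_{B(a,2L)} U](x) − κ| ≤ C_K · L · ∫_{B(a,2L)ᶜ} ‖U(y)‖²/‖y − a‖⁴ dy`,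
with `C_K` the absolute constant of the tree's two-centre kernel bound
`exists_abs_integral_pressureKernel_sub_le` (Robinson–Rodrigo–Sadowski (15.35) in mean-value form;
Kang–Miura–Tsai's `|p_far| ≤ ∫_{2r<|y−x₀|} c r |x₀−y|⁻⁴ |v|²`).  Additivity
`Π[U] = Π[1_{B(a,2L)}U] + Π[1_{B(a,2L)ᶜ}U]` plus the far-field representation above. [folklore] -/
theorem exists_ae_abs_rieszPressure_sub_near_sub_const_le :
    ∃ C : ℝ, 0 ≤ C ∧ ∀ (U : EuclideanSpace ℝ (Fin 3) → EuclideanSpace ℝ (Fin 3)),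
      MemLp U 3 volume → ∀ (a : EuclideanSpace ℝ (Fin 3)) (L : ℝ), 0 < L →
        ∃ κ : ℝ, ∀ᵐ x ∂(volume.restrict (ball a L)),
          |rieszPressure U x - rieszPressure ((ball a (2 * L)).indicator U) x - κ| ≤
            C * L * ∫ y in (ball a (2 * L))ᶜ, ‖U y‖ ^ 2 / ‖y - a‖ ^ 4 := by
  obtain ⟨C, hC0, hC⟩ := exists_abs_integral_pressureKernel_sub_le
  refine ⟨C, hC0, fun U hU a L hL => ?_⟩
  set B₂ : Set (EuclideanSpace ℝ (Fin 3)) := ball a (2 * L) with hB₂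
  set U₁ : EuclideanSpace ℝ (Fin 3) → EuclideanSpace ℝ (Fin 3) := B₂.indicator U with hU₁
  set U₂ : EuclideanSpace ℝ (Fin 3) → EuclideanSpace ℝ (Fin 3) := B₂ᶜ.indicator U with hU₂
  have hU₁3 : MemLp U₁ 3 volume := hU.indicator measurableSet_ball
  have hU₂3 : MemLp U₂ 3 volume := hU.indicator measurableSet_ball.compl
  have hvan : ∀ y ∈ ball a (2 * L), U₂ y = 0 := fun y hy => by
    simp only [hU₂]
    exact indicator_of_notMem (show y ∉ B₂ᶜ from fun h => h hy) _
  set κ : ℝ := ∫ y, pressureKernel (a - y) (U₂ y) with hκ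
  refine ⟨κ, ?_⟩
  -- additivity
  have hadd : rieszPressure U =ᵐ[volume] fun x => rieszPressure U₁ x + rieszPressure U₂ x := by
    refine rieszPressure_add_ae_eq_of_disjoint hU hU₁3 hU₂3 (fun y => ?_) (ae_of_all _ fun y => ?_)
    · by_cases hy : y ∈ B₂
      · right
        simp only [hU₂]
        exact indicator_of_notMem (show y ∉ B₂ᶜ from fun h => h hy) _
      · left
        simp only [hU₁]
        exact indicator_of_notMem hy _
    · simp only [hU₁, hU₂]
      rw [Set.indicator_self_add_compl]
  -- far-field representation on `B(a, L)` (`L < 2L`)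
  have hrep := rieszPressure_ae_eq_integral_pressureKernel_of_vanish hU₂3 hL (by linarith) hvan
  -- the weight
  have hWi : IntegrableOn (fun y => ‖U y‖ ^ 2 / ‖y - a‖ ^ 4) B₂ᶜ volume :=
    integrableOn_norm_sq_div_norm_sub_pow_four hU a (by linarith)
  have hW₂ : Integrable (fun y => ‖U₂ y‖ ^ 2 / ‖y - a‖ ^ 4) := by
    refine (hWi.integrable_indicator measurableSet_ball.compl).congr
      (Eventually.of_forall fun y => ?_)
    simp only [hU₂]
    by_cases hy : y ∈ B₂ᶜ
    · rw [indicator_of_mem hy, indicator_of_mem hy]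
    · rw [indicator_of_notMem hy, indicator_of_notMem hy, norm_zero, zero_pow two_ne_zero, zero_div]
  have hW₂eq : ∫ y, ‖U₂ y‖ ^ 2 / ‖y - a‖ ^ 4 = ∫ y in B₂ᶜ, ‖U y‖ ^ 2 / ‖y - a‖ ^ 4 := by
    rw [← integral_indicator measurableSet_ball.compl]
    refine integral_congr_ae (Eventually.of_forall fun y => ?_)
    simp only [hU₂]
    by_cases hy : y ∈ B₂ᶜ
    · rw [indicator_of_mem hy, indicator_of_mem hy]
    · rw [indicator_of_notMem hy, indicator_of_notMem hy, norm_zero, zero_pow two_ne_zero, zero_div]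
  -- integrability of the kernel integrand at the centre
  have hia : Integrable (fun y => pressureKernel (a - y) (U₂ y)) :=
    integrable_pressureKernel_of_vanish hU₂3 hL (by linarith : L < 2 * L) hvan (mem_ball_self hL)
  have hmem : ∀ᵐ x ∂(volume.restrict (ball a L)), x ∈ ball a L := ae_restrict_mem measurableSet_ball
  filter_upwards [ae_restrict_of_ae (s := ball a L) hadd, hrep, hmem] with x hx hxrep hxB
  have hix : Integrable (fun y => pressureKernel (x - y) (U₂ y)) :=
    integrable_pressureKernel_of_vanish hU₂3 hL (by linarith : L < 2 * L) hvan hxB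
  have key := hC U₂ a x L hvan hxB hix hia hW₂
  rw [hx, hxrep, hW₂eq] at *
  have e : rieszPressure U₁ x + (∫ y, pressureKernel (x - y) (U₂ y)) - rieszPressure U₁ x - κ =
      (∫ y, pressureKernel (x - y) (U₂ y)) - ∫ y, pressureKernel (a - y) (U₂ y) := by
    rw [hκ]; ring
  rw [e]
  calc |(∫ y, pressureKernel (x - y) (U₂ y)) - ∫ y, pressureKernel (a - y) (U₂ y)|
      ≤ C * ‖x - a‖ * ∫ y in B₂ᶜ, ‖U y‖ ^ 2 / ‖y - a‖ ^ 4 := key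
    _ ≤ C * L * ∫ y in B₂ᶜ, ‖U y‖ ^ 2 / ‖y - a‖ ^ 4 := by
        have hxa : ‖x - a‖ ≤ L := by
          rw [mem_ball, dist_eq_norm] at hxB
          exact hxB.le
        have hI0 : 0 ≤ ∫ y in B₂ᶜ, ‖U y‖ ^ 2 / ‖y - a‖ ^ 4 :=
          integral_nonneg fun y => by positivity
        gcongr

end Summit.NavierStokesRegularity.NavierStokesRegularity.Theorems.ThinCascade

end
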